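import Literature.NumberTheory.Automorphic.ArchRankinSelbergTestVector
import Literature.NumberTheory.Automorphic.PairLFunctionNeConjLevelOneOfArch
import Literature.Analysis.FunctionSpaces.GaussianSchwartz
import HarnessLib

/-!
# Mœglin–Waldspurger (i)(b) for everywhere-unramified level-one pairs from the archimedean test vector

Topic `NumberTheory/Automorphic`; namespace `Literature.NumberTheory.Automorphic`. Theorems only (no
definition, no named fact). The reduction
`exists_entire_eq_partialPairL_of_levelOne_of_archPairLFactorData`
(`PairLFunctionNeConjLevelOneOfArch`) of the conclusion of the named fact
`MoeglinWaldspurger1989_partialPairL_entire_of_ne_conj` for everywhere-unramified level-one pairs over a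
number field with trivial different takes the archimedean local theory as the spelled-out hypothesis
`hX`: finitely many `K_∞`-finite Gårding data with NON-NEGATIVE Schwartz test functions and an entire
`Λ` with `Λ(s) Σ_i Ψ_∞(s; W_{e_i}, W̄'_{e'_i}, Φ_{i,∞}) = 1` on `re s > 1`. This file derives `hX` from the
named fact `HumphriesJo2024_archRankinSelberg_testVector` (`ArchRankinSelbergTestVector`: ONE test
vector with a polynomial-times-Gaussian `Φ_∞` and `Ψ_∞ = c^s ∏ Γ_ℝ(s + a_j) ∏ Γ_ℂ(s + b_j)`, plus the
absolute convergence of the integrals for such data):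

* the polynomial is split into monomials and each real monomial `M` is written
  `M = ½ (M + 1)² - ½ M² - ½`, so that `Φ_∞ = Σ_d q_d (½ (M_d + 1)² G - ½ M_d² G - ½ G)` with
  NON-NEGATIVE pieces `½ (M_d + 1)² G`, `½ M_d² G`, `½ G` — each a polynomial times the Gaussian `G`, hence
  continuous, Schwartz (`SchwartzMap.smulLeftCLM` with a function of temperate growth) and with an
  integrable integrand (clause (ii) of the fact), so that the integral is additive in `Φ_∞`;
* the complex coefficients `q_d, -q_d, -q_d` are absorbed into the first vector (`Ψ_∞` is linear in `e`);
* `Λ(s) = c^{-s} ∏ Γ_ℝ(s + a_j)⁻¹ ∏ Γ_ℂ(s + b_j)⁻¹` is entire (`Complex.differentiable_Gammaℝ_inv`,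
  `Complex.differentiable_one_div_Gamma`) and `Λ · Ψ_∞ = 1` on `re s > 1` (`re a_j, re b_j > -1`).

Main statements: `archPairLFactorData_of_testVector` (the hypothesis `hX` from the named fact) and
`exists_entire_eq_partialPairL_of_levelOne_of_testVector` — **for `0 < n`, multiplicity one, `𝔡_K = 1`,
and cuspidal `π ≠ σ̄` on `GL_n(𝔸_K)` with `K(1)`-fixed Hecke eigenvectors at every finite place,
`L^S(s, π × σ)` is entire for every finite `S`, from `HumphriesJo2024_archRankinSelberg_testVector n K`
alone** (Cogdell (2004), §4.1–§4.2; Mœglin–Waldspurger (1989), Appendice, Cor. (i)(b)).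

## References

* C. Mœglin, J.-L. Waldspurger, *Le spectre résiduel de GL(n)*, Ann. Sci. ÉNS 22 (1989), Appendice,
  Corollaire (i)(b), p. 667 [MoeglinWaldspurger1989].
* J. W. Cogdell, *Analytic theory of L-functions for GL_n* (2004), §3.2, §4.1, §4.2
  [CogdellAnalyticTheory2004].
* P. Humphries, Y. Jo, *Test vectors for archimedean period integrals*, Publ. Mat. 68 (2024),
  Thm. 1.1, Thm. 5.6 [HumphriesJo2024].
-/

noncomputable section

open MeasureTheory Measure NumberField NumberField.mixedEmbedding IsDedekindDomain Set Filter
open Literature.NumberTheory.GaloisRepresentations (ideleGroup)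
open scoped MatrixGroups ENNReal NNReal Classical ComplexConjugate

namespace Literature.NumberTheory.Automorphic

/-! ### Polynomials times Gaussians on `K_∞ⁿ`: continuity, temperate growth, Schwartz -/

section PolyGauss

variable {n : ℕ} {K : Type} [Field K] [NumberField K]

/-- The coordinate map `K_∞ⁿ → (K ⊗ ℝ)ⁿ` (`InfiniteAdeleRing.ringEquiv_mixedSpace` coordinatewise). [folklore] -/
abbrev infArchCoords (n : ℕ) (K : Type) [Field K] [NumberField K] (z : Fin n → InfiniteAdeleRing K) :
    Fin n → mixedSpace K :=
  fun j => InfiniteAdeleRing.ringEquiv_mixedSpace K (z j)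

/-- The coordinate map `K_∞ⁿ → (K ⊗ ℝ)ⁿ` is continuous. [folklore] -/
theorem continuous_infArchCoords : Continuous (infArchCoords n K) :=
  continuous_pi fun j => (continuous_ringEquiv_mixedSpace K).comp (continuous_apply j)

/-- The coordinate map `K_∞ⁿ → (K ⊗ ℝ)ⁿ` is surjective (a coordinatewise ring isomorphism). [folklore] -/
theorem infArchCoords_surjective : Function.Surjective (infArchCoords n K) := fun x =>
  ⟨fun j => (InfiniteAdeleRing.ringEquiv_mixedSpace K).symm (x j), funext fun _ => RingEquiv.apply_symm_apply _ _⟩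

variable {N : ℕ} (L : Fin N → ((Fin n → mixedSpace K) →L[ℝ] ℝ))

/-- A real monomial in continuous linear coordinates has temperate growth. [folklore] -/
theorem hasTemperateGrowth_monomial (d : Fin N →₀ ℕ) :
    Function.HasTemperateGrowth fun x : Fin n → mixedSpace K => ∏ i, (L i x) ^ (d i) := by
  classical
  have h : ∀ (s : Finset (Fin N)), Function.HasTemperateGrowth
      fun x : Fin n → mixedSpace K => ∏ i ∈ s, (L i x) ^ (d i) := by
    intro s
    induction s using Finset.induction_on with
    | empty =>
      simp only [Finset.prod_empty]
      exact Function.HasTemperateGrowth.const 1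
    | insert a s has ih =>
      simp only [Finset.prod_insert has]
      exact (((L a).hasTemperateGrowth).pow (d a)).mul ih
  exact h Finset.univ

/-- A complex-valued function of temperate growth from a real one. [folklore] -/
theorem hasTemperateGrowth_ofReal_comp {f : (Fin n → mixedSpace K) → ℝ} (hf : Function.HasTemperateGrowth f) :
    Function.HasTemperateGrowth fun x => ((f x : ℝ) : ℂ) :=
  (Complex.ofRealCLM.hasTemperateGrowth).comp hf

/-- **A real function of temperate growth times the Gaussian `exp(-‖T x‖²)` is (the restriction to real
values of) a Schwartz function on `K_∞ⁿ`.** [folklore] -/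
theorem exists_schwartzMap_mul_gauss
    (T : (Fin n → mixedSpace K) ≃L[ℝ] EuclideanSpace ℝ (Fin (Module.finrank ℝ (Fin n → mixedSpace K))))
    {r : (Fin n → mixedSpace K) → ℝ} (hr : Function.HasTemperateGrowth r) :
    ∃ Ψ : SchwartzMap (Fin n → mixedSpace K) ℂ, ∀ z : Fin n → InfiniteAdeleRing K,
      (((r (infArchCoords n K z) * Real.exp (-‖T (infArchCoords n K z)‖ ^ 2) : ℝ)) : ℂ) = Ψ (infArchCoords n K z) := by
  set Γ : SchwartzMap (Fin n → mixedSpace K) ℂ :=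
    SchwartzMap.compCLMOfContinuousLinearEquiv ℂ T
      (Literature.Analysis.FunctionSpaces.gaussianSchwartz _ 1) with hΓ
  have hΓapp : ∀ x, Γ x = ((Real.exp (-‖T x‖ ^ 2) : ℝ) : ℂ) := fun x => by
    rw [hΓ, SchwartzMap.compCLMOfContinuousLinearEquiv_apply, Function.comp_apply,
      Literature.Analysis.FunctionSpaces.gaussianSchwartz_apply one_pos, neg_mul, one_mul]
  have hrc : Function.HasTemperateGrowth fun x => ((r x : ℝ) : ℂ) := hasTemperateGrowth_ofReal_comp hr
  refine ⟨SchwartzMap.smulLeftCLM ℂ (fun x => ((r x : ℝ) : ℂ)) Γ, fun z => ?_⟩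
  rw [SchwartzMap.smulLeftCLM_apply_apply hrc, hΓapp, smul_eq_mul, Complex.ofReal_mul]

end PolyGauss

/-! ### Linearity of the archimedean pair integral in the first vector -/

section Linear

variable {n : ℕ} {K : Type} [Field K] [NumberField K]
variable (hcpt : isCompact_glFiniteIntegralLevel n K)
  {E : Type*} [NormedAddCommGroup E] [NormedSpace ℂ E] [CompleteSpace E]
  {E' : Type*} [NormedAddCommGroup E'] [NormedSpace ℂ E'] [CompleteSpace E']
  (τ : ContRepresentation ℂ (AutomorphyDatum.gl n K hcpt).arch.carrier E) (hτ : τ.IsStronglyContinuous)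
  (τ' : ContRepresentation ℂ (AutomorphyDatum.gl n K hcpt).arch.carrier E') (hτ' : τ'.IsStronglyContinuous)

/-- `Ψ_∞(s; W_{c e}, W̄'_{e'}, Φ) = c · Ψ_∞(s; W_e, W̄'_{e'}, Φ)`. [folklore] -/
theorem archRankinSelbergPairIntegral_smul (ℓ : archGardingSpace hcpt τ →ₗ[ℂ] ℂ)
    (ℓ' : archGardingSpace hcpt τ' →ₗ[ℂ] ℂ) (c : ℂ) (e : archGardingSpace hcpt τ) (e' : archGardingSpace hcpt τ')
    (Φinf : (Fin n → InfiniteAdeleRing K) → ℝ)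
    [MeasurableSpace (GL (Fin n) (mixedSpace K))] [MeasurableSpace ((mixedSpace K)ˣ)]
    (μA : Measure (Fin n → (mixedSpace K)ˣ)) (μK : Measure ↥(Kinf n K)) (s : ℂ) :
    archRankinSelbergPairIntegral hcpt τ hτ τ' hτ' ℓ ℓ' (c • e) e' Φinf μA μK s =
      c * archRankinSelbergPairIntegral hcpt τ hτ τ' hτ' ℓ ℓ' e e' Φinf μA μK s := by
  rw [archRankinSelbergPairIntegral_def, archRankinSelbergPairIntegral_def, ← integral_const_mul]
  congr 1 with p
  have h : (⟨τ (toArch hcpt (glDiagonal n (mixedSpace K) p.1 * (p.2 : GL (Fin n) (mixedSpace K)))) ((c • e : archGardingSpace hcpt τ) : E),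
      apply_mem_archGardingSpace hτ _ (c • e).2⟩ : archGardingSpace hcpt τ) =
      c • ⟨τ (toArch hcpt (glDiagonal n (mixedSpace K) p.1 * (p.2 : GL (Fin n) (mixedSpace K)))) (e : E),
        apply_mem_archGardingSpace hτ _ e.2⟩ := by
    apply Subtype.ext
    change τ _ ((c • e : archGardingSpace hcpt τ) : E) = c • τ _ (e : E)
    rw [Submodule.coe_smul, map_smul]
  rw [h, map_smul, smul_eq_mul]
  ring

end Linear

/-! ### The hypothesis `hX` from the named fact -/

section Bridge

variable {n : ℕ} {K : Type} [Field K] [NumberField K]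

/-- `Γ_ℂ(s)⁻¹` is entire. [folklore] -/
theorem differentiable_Gammaℂ_inv : Differentiable ℂ fun s : ℂ => (Complex.Gammaℂ s)⁻¹ := by
  have h : (fun s : ℂ => (Complex.Gammaℂ s)⁻¹) = fun s => (2 : ℂ)⁻¹ * (2 * (Real.pi : ℂ)) ^ s * (Complex.Gamma s)⁻¹ := by
    funext s
    rw [Complex.Gammaℂ_def, mul_inv, mul_inv, Complex.cpow_neg, inv_inv]
  rw [h]
  refine ((differentiable_const _).mul ?_).mul Complex.differentiable_one_div_Gamma
  exact differentiable_id.const_cpow (Or.inl (mul_ne_zero two_ne_zero (Complex.ofReal_ne_zero.2 Real.pi_ne_zero)))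

/-- `Γ_ℂ(s) ≠ 0` for `re s > 0`. [folklore] -/
theorem Gammaℂ_ne_zero_of_re_pos {s : ℂ} (hs : 0 < s.re) : Complex.Gammaℂ s ≠ 0 := by
  rw [Complex.Gammaℂ_def]
  refine mul_ne_zero (mul_ne_zero two_ne_zero ?_) (Complex.Gamma_ne_zero_of_re_pos hs)
  rw [Ne, Complex.cpow_eq_zero_iff, not_and_or]
  exact Or.inl (mul_ne_zero two_ne_zero (Complex.ofReal_ne_zero.2 Real.pi_ne_zero))

/-- The algebraic identity behind the splitting of a polynomial into non-negative pieces: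
`m = ½ (m + 1)² - ½ m² - ½`. [folklore] -/
theorem eq_half_sq_add_one_sub (m : ℝ) : m = (m + 1) ^ 2 / 2 - m ^ 2 / 2 - 1 / 2 := by ring

/-- Evaluation of a complex polynomial at real arguments as a combination of the NON-NEGATIVE real
polynomials `½ (M_d + 1)²`, `½ M_d²`, `½` (`M_d` the monomials). [folklore] -/
theorem eval_ofReal_eq_sum_pieces {N : ℕ} (X : Fin N → ℝ) (q : MvPolynomial (Fin N) ℂ) :
    MvPolynomial.eval (fun i => ((X i : ℝ) : ℂ)) q =
      (∑ d : q.support, q.coeff d * ((((∏ i, X i ^ (d : Fin N →₀ ℕ) i) + 1) ^ 2 / 2 : ℝ) : ℂ)) +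
      ((∑ d : q.support, -q.coeff d * ((((∏ i, X i ^ (d : Fin N →₀ ℕ) i)) ^ 2 / 2 : ℝ) : ℂ)) +
        ∑ d : q.support, -q.coeff d * (((1 / 2 : ℝ)) : ℂ)) := by
  rw [Finset.sum_coe_sort q.support (fun d => q.coeff d * ((((∏ i, X i ^ d i) + 1) ^ 2 / 2 : ℝ) : ℂ)),
    Finset.sum_coe_sort q.support (fun d => -q.coeff d * ((((∏ i, X i ^ d i)) ^ 2 / 2 : ℝ) : ℂ)),
    Finset.sum_coe_sort q.support (fun d => -q.coeff d * (((1 / 2 : ℝ)) : ℂ)),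
    MvPolynomial.eval_eq', ← Finset.sum_add_distrib, ← Finset.sum_add_distrib]
  refine Finset.sum_congr rfl fun d _ => ?_
  have hprod : (∏ i, ((X i : ℝ) : ℂ) ^ d i) = (((∏ i, X i ^ d i : ℝ)) : ℂ) := by
    rw [Complex.ofReal_prod]
    simp only [Complex.ofReal_pow]
  rw [hprod]
  conv_lhs => rw [eq_half_sq_add_one_sub (∏ i, X i ^ d i)]
  push_cast
  ring

/-- Differentiability of a finite product of functions, pointwise form. [folklore] -/
theorem differentiable_fun_finset_prod {ι : Type*} (s : Finset ι) {f : ι → ℂ → ℂ}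
    (hf : ∀ i ∈ s, Differentiable ℂ (f i)) : Differentiable ℂ fun z => ∏ i ∈ s, f i z := by
  have h : (fun z => ∏ i ∈ s, f i z) = ∏ i ∈ s, f i := by
    funext z
    simp only [Finset.prod_apply]
  rw [h]
  exact Differentiable.finsetProd hf

attribute [local instance] Literature.MeasureTheory.Group.Units.borelSpace_of_isOpenEmbedding
  Literature.MeasureTheory.Group.Units.secondCountableTopology
  Literature.MeasureTheory.Group.Units.locallyCompactSpace

attribute [local instance] borelSpace_pi_mixedUnits measurableMul_pi_mixedUnits

set_option maxHeartbeats 1600000 in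
/-- **The hypothesis `hX` of `exists_entire_eq_partialPairL_of_levelOne_of_archPairLFactorData` from the
named fact `HumphriesJo2024_archRankinSelberg_testVector`** (module docstring: split the polynomial of
the test function into non-negative pieces, absorb the coefficients into the first vector, invert the
`Γ`-product). [cite: HumphriesJo2024, Thm. 1.1 and Thm. 5.6] [cite: CogdellAnalyticTheory2004, §3.2 and §4.1] -/
theorem archPairLFactorData_of_testVector (h : HumphriesJo2024_archRankinSelberg_testVector n K) :
    ∀ (hcpt : isCompact_glFiniteIntegralLevel n K)
      (E : Type) [NormedAddCommGroup E] [InnerProductSpace ℂ E] [CompleteSpace E]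
      (τ : ContRepresentation ℂ (AutomorphyDatum.gl n K hcpt).arch.carrier E) (hτ : τ.IsStronglyContinuous)
      (_ : τ.IsUnitary) (_ : τ.IsTopIrreducible)
      (ℓ : archGardingSpace hcpt τ →ₗ[ℂ] ℂ) (_ : IsArchContWhittakerFunctional hcpt τ hτ ℓ) (_ : ℓ ≠ 0)
      (E' : Type) [NormedAddCommGroup E'] [InnerProductSpace ℂ E'] [CompleteSpace E']
      (τ' : ContRepresentation ℂ (AutomorphyDatum.gl n K hcpt).arch.carrier E') (hτ' : τ'.IsStronglyContinuous)
      (_ : τ'.IsUnitary) (_ : τ'.IsTopIrreducible)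
      (ℓ' : archGardingSpace hcpt τ' →ₗ[ℂ] ℂ) (_ : IsArchContWhittakerFunctional hcpt τ' hτ' ℓ') (_ : ℓ' ≠ 0)
      [MeasurableSpace (GL (Fin n) (mixedSpace K))] [BorelSpace (GL (Fin n) (mixedSpace K))]
      [MeasurableSpace ((mixedSpace K)ˣ)] [BorelSpace ((mixedSpace K)ˣ)]
      (μA : Measure (Fin n → (mixedSpace K)ˣ)) (_ : IsHaarMeasure μA)
      (μK : Measure ↥(Kinf n K)) (_ : IsHaarMeasure μK),
      ∃ (m : ℕ) (e : Fin m → archGardingSpace hcpt τ) (e' : Fin m → archGardingSpace hcpt τ')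
        (_ : ∀ i, FiniteDimensional ℂ (Submodule.span ℂ (Set.range
          fun κ : (AutomorphyDatum.gl n K hcpt).arch.maximalCompact => τ (toArch hcpt (κ : GL (Fin n) (mixedSpace K))) (e i : E))))
        (_ : ∀ i, FiniteDimensional ℂ (Submodule.span ℂ (Set.range
          fun κ : (AutomorphyDatum.gl n K hcpt).arch.maximalCompact => τ' (toArch hcpt (κ : GL (Fin n) (mixedSpace K))) (e' i : E'))))
        (Φinf : Fin m → (Fin n → InfiniteAdeleRing K) → ℝ) (_ : ∀ i, Continuous (Φinf i))
        (_ : ∀ i z, 0 ≤ Φinf i z)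
        (_ : ∀ i, ∃ Ψ : SchwartzMap (Fin n → mixedSpace K) ℂ, ∀ z : Fin n → InfiniteAdeleRing K,
          ((Φinf i z : ℝ) : ℂ) = Ψ fun j => InfiniteAdeleRing.ringEquiv_mixedSpace K (z j))
        (Λ : ℂ → ℂ), Differentiable ℂ Λ ∧ ∀ s : ℂ, 1 < s.re →
          Λ s * ∑ i, archRankinSelbergPairIntegral hcpt τ hτ τ' hτ' ℓ ℓ' (e i) (e' i) (Φinf i) μA μK s = 1 := by
  intro hcpt E _ _ _ τ hτ hτu hτi ℓ hℓ hℓ0 E' _ _ _ τ' hτ' hτu' hτi' ℓ' hℓ' hℓ'0 _ _ _ _ μA hμA μK hμK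
  classical
  obtain ⟨⟨e, e', hfin, hfin', Φ, hΦ, c, hc, d₁, d₂, a, b, ha, hb, hΨ⟩, hint⟩ :=
    h hcpt E τ hτ hτu hτi ℓ hℓ hℓ0 E' τ' hτ' hτu' hτi' ℓ' hℓ' hℓ'0 μA hμA μK hμK
  obtain ⟨N, L, q, T, hΦq⟩ := hΦ
  -- the Gaussian, the monomials, the non-negative pieces and their coefficients
  set G : (Fin n → InfiniteAdeleRing K) → ℝ := fun z => Real.exp (-‖T (infArchCoords n K z)‖ ^ 2) with hG
  set M : (Fin N →₀ ℕ) → (Fin n → mixedSpace K) → ℝ := fun d x => ∏ i, (L i x) ^ (d i) with hM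
  set Rs : ↥q.support ⊕ (↥q.support ⊕ ↥q.support) → (Fin n → mixedSpace K) → ℝ :=
    Sum.elim (fun d x => (M d.1 x + 1) ^ 2 / 2) (Sum.elim (fun d x => (M d.1 x) ^ 2 / 2) (fun _ _ => (1 / 2 : ℝ)))
    with hRs
  set coef : ↥q.support ⊕ (↥q.support ⊕ ↥q.support) → ℂ := Sum.elim (fun d => q.coeff d.1) (Sum.elim (fun d => -q.coeff d.1) (fun d => -q.coeff d.1))
    with hcoef
  set qs : ↥q.support ⊕ (↥q.support ⊕ ↥q.support) → MvPolynomial (Fin N) ℂ :=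
    Sum.elim (fun d => MvPolynomial.C (1 / 2 : ℂ) * (MvPolynomial.monomial d.1 1 + 1) ^ 2)
      (Sum.elim (fun d => MvPolynomial.C (1 / 2 : ℂ) * (MvPolynomial.monomial d.1 1) ^ 2)
        (fun _ => MvPolynomial.C (1 / 2 : ℂ))) with hqs
  set piece : ↥q.support ⊕ (↥q.support ⊕ ↥q.support) → (Fin n → InfiniteAdeleRing K) → ℝ := fun i z => Rs i (infArchCoords n K z) * G z with hpiece
  -- temperate growth, non-negativity, continuity of the real polynomials `Rs i`
  have hMt : ∀ d, Function.HasTemperateGrowth (M d) := fun d => hasTemperateGrowth_monomial L d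
  have hRt : ∀ i, Function.HasTemperateGrowth (Rs i) := by
    rintro (d | d | d)
    · exact (((hMt d.1).add (Function.HasTemperateGrowth.const 1)).pow 2).mul (Function.HasTemperateGrowth.const _)
    · exact ((hMt d.1).pow 2).mul (Function.HasTemperateGrowth.const _)
    · exact Function.HasTemperateGrowth.const _
  have hR0 : ∀ i x, 0 ≤ Rs i x := by
    rintro (d | d | d) x
    · change 0 ≤ (M d.1 x + 1) ^ 2 / 2; positivity
    · change 0 ≤ (M d.1 x) ^ 2 / 2; positivity
    · change (0 : ℝ) ≤ 1 / 2; positivity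
  have hRc : ∀ i, Continuous (Rs i) := fun i => (hRt i).1.continuous
  -- the pieces are polynomials times the Gaussian
  have hmono : ∀ (d : Fin N →₀ ℕ) (z : Fin n → InfiniteAdeleRing K),
      MvPolynomial.eval (fun j => ((L j (infArchCoords n K z) : ℝ) : ℂ)) (MvPolynomial.monomial d (1 : ℂ)) =
        ((M d (infArchCoords n K z) : ℝ) : ℂ) := fun d z => by
    rw [MvPolynomial.eval_monomial, one_mul, Finsupp.prod_fintype _ _ fun j => pow_zero _, hM]
    simp only [Complex.ofReal_prod, Complex.ofReal_pow]
  have hqsR : ∀ i (z : Fin n → InfiniteAdeleRing K),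
      MvPolynomial.eval (fun j => ((L j (infArchCoords n K z) : ℝ) : ℂ)) (qs i) = ((Rs i (infArchCoords n K z) : ℝ) : ℂ) := by
    rintro (d | d | d) z
    · change MvPolynomial.eval _ (MvPolynomial.C (1 / 2 : ℂ) * (MvPolynomial.monomial d.1 1 + 1) ^ 2) =
        (((M d.1 (infArchCoords n K z) + 1) ^ 2 / 2 : ℝ) : ℂ)
      rw [map_mul, MvPolynomial.eval_C, map_pow, map_add, map_one (MvPolynomial.eval _), hmono]
      push_cast
      ring
    · change MvPolynomial.eval _ (MvPolynomial.C (1 / 2 : ℂ) * (MvPolynomial.monomial d.1 1) ^ 2) =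
        (((M d.1 (infArchCoords n K z)) ^ 2 / 2 : ℝ) : ℂ)
      rw [map_mul, MvPolynomial.eval_C, map_pow, hmono]
      push_cast
      ring
    · change MvPolynomial.eval _ (MvPolynomial.C (1 / 2 : ℂ)) = (((1 / 2 : ℝ)) : ℂ)
      rw [MvPolynomial.eval_C]
      push_cast
      ring
  have hpiecePG : ∀ i, IsArchPolyGaussian n K fun z => ((piece i z : ℝ) : ℂ) := fun i =>
    ⟨N, L, qs i, T, fun z => by rw [hqsR i z]; simp only [hpiece, Complex.ofReal_mul]; rfl⟩
  -- the index set `Fin m`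
  set m : ℕ := Fintype.card (↥q.support ⊕ (↥q.support ⊕ ↥q.support)) with hm
  set σ : Fin m ≃ (↥q.support ⊕ (↥q.support ⊕ ↥q.support)) := (Fintype.equivFin _).symm with hσ
  refine ⟨m, fun k => coef (σ k) • e, fun _ => e', fun k => ?_, fun _ => hfin',
    fun k => piece (σ k), fun k => ?_, fun k z => ?_, fun k => ?_,
    fun s => (c : ℂ) ^ (-s) * ((∏ j, (Complex.Gammaℝ (s + a j))⁻¹) * ∏ j, (Complex.Gammaℂ (s + b j))⁻¹),
    ?_, fun s hs => ?_⟩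
  · -- `K_∞`-finiteness of `coef • e`
    haveI := hfin
    refine Submodule.finiteDimensional_of_le
      (S₂ := Submodule.span ℂ (Set.range fun κ : (AutomorphyDatum.gl n K hcpt).arch.maximalCompact =>
        τ (toArch hcpt (κ : GL (Fin n) (mixedSpace K))) (e : E))) (Submodule.span_le.2 ?_)
    rintro _ ⟨κ, rfl⟩
    have hsm : τ (toArch hcpt (κ : GL (Fin n) (mixedSpace K))) ((coef (σ k) • e : archGardingSpace hcpt τ) : E) =
        coef (σ k) • τ (toArch hcpt (κ : GL (Fin n) (mixedSpace K))) (e : E) := by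
      rw [Submodule.coe_smul, map_smul]
    show τ (toArch hcpt (κ : GL (Fin n) (mixedSpace K))) ((coef (σ k) • e : archGardingSpace hcpt τ) : E) ∈ _
    rw [hsm]
    exact Submodule.smul_mem _ _ (Submodule.subset_span ⟨κ, rfl⟩)
  · -- continuity of the pieces
    exact ((hRc _).comp continuous_infArchCoords).mul
      (Real.continuous_exp.comp ((continuous_norm.comp (T.continuous.comp continuous_infArchCoords)).pow 2).neg)
  · -- non-negativity
    exact mul_nonneg (hR0 _ _) (Real.exp_pos _).le
  · -- Schwartz
    obtain ⟨Ψ, hΨ'⟩ := exists_schwartzMap_mul_gauss T (hRt (σ k))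
    exact ⟨Ψ, fun z => hΨ' z⟩
  · -- `Λ` is entire
    refine (differentiable_id.neg.const_cpow (Or.inl (Complex.ofReal_ne_zero.2 hc.ne'))).mul
      ((differentiable_fun_finset_prod _ fun j _ => ?_).mul (differentiable_fun_finset_prod _ fun j _ => ?_))
    · exact Complex.differentiable_Gammaℝ_inv.comp (differentiable_id.add_const _)
    · exact differentiable_Gammaℂ_inv.comp (differentiable_id.add_const _)
  · -- the identity on `re s > 1`
    -- integrability of the pieces (clause (ii) of the fact)
    have hpieceInt : ∀ i, Integrable (fun p : (Fin n → (mixedSpace K)ˣ) × ↥(Kinf n K) =>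
        ℓ ⟨τ (toArch hcpt (glDiagonal n (mixedSpace K) p.1 * (p.2 : GL (Fin n) (mixedSpace K)))) (e : E),
            apply_mem_archGardingSpace hτ _ e.2⟩ *
          conj (ℓ' ⟨τ' (toArch hcpt (glDiagonal n (mixedSpace K) p.1 * (p.2 : GL (Fin n) (mixedSpace K))))
            (e' : E'), apply_mem_archGardingSpace hτ' _ e'.2⟩) *
          ((piece i (archLastRow n K (glDiagonal n (mixedSpace K) p.1 * (p.2 : GL (Fin n) (mixedSpace K)))) : ℝ) : ℂ) *
          archTorusWeightC n K s p.1) (μA.prod μK) := fun i =>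
      hint e e' hfin hfin' (fun z => ((piece i z : ℝ) : ℂ)) (hpiecePG i) s hs
    -- pointwise decomposition of `Φ`
    have hΦpt : ∀ w : Fin n → InfiniteAdeleRing K,
        Φ w = ∑ i : ↥q.support ⊕ (↥q.support ⊕ ↥q.support), coef i * ((piece i w : ℝ) : ℂ) := by
      intro w
      rw [hΦq w]
      change MvPolynomial.eval (fun j => ((L j (infArchCoords n K w) : ℝ) : ℂ)) q * ((G w : ℝ) : ℂ) = _
      rw [eval_ofReal_eq_sum_pieces, add_mul, add_mul, Finset.sum_mul, Finset.sum_mul, Finset.sum_mul,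
        Fintype.sum_sum_type, Fintype.sum_sum_type]
      simp only [hcoef, hpiece, hRs, hM, Sum.elim_inl, Sum.elim_inr]
      refine congrArg₂ (· + ·) (Finset.sum_congr rfl fun d _ => ?_)
        (congrArg₂ (· + ·) (Finset.sum_congr rfl fun d _ => ?_) (Finset.sum_congr rfl fun d _ => ?_)) <;>
      · push_cast; ring
    -- the sum of the archimedean integrals of the data is `Ψ_∞(s; e, e', Φ)`
    have hsum : ∑ k : Fin m, archRankinSelbergPairIntegral hcpt τ hτ τ' hτ' ℓ ℓ'
        (coef (σ k) • e) e' (piece (σ k)) μA μK s =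
        archRankinSelbergPairIntegralCplx hcpt τ hτ τ' hτ' ℓ ℓ' e e' Φ μA μK s := by
      rw [Equiv.sum_comp σ (fun i => archRankinSelbergPairIntegral hcpt τ hτ τ' hτ' ℓ ℓ'
        (coef i • e) e' (piece i) μA μK s)]
      simp only [archRankinSelbergPairIntegral_smul]
      rw [archRankinSelbergPairIntegralCplx]
      simp_rw [hΦpt, Finset.mul_sum, Finset.sum_mul]
      rw [integral_finsetSum _ fun i _ => ((hpieceInt i).const_mul (coef i)).congr ?_]
      · refine Finset.sum_congr rfl fun i _ => ?_
        rw [archRankinSelbergPairIntegral_def, ← integral_const_mul]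
        congr 1 with p
        ring
      · exact Filter.Eventually.of_forall fun p => by ring
    rw [hsum, hΨ s hs]
    -- `Λ(s) · c^s ∏ Γ = 1`
    have hcs : (c : ℂ) ^ s ≠ 0 := by
      rw [Ne, Complex.cpow_eq_zero_iff, not_and_or]
      exact Or.inl (Complex.ofReal_ne_zero.2 hc.ne')
    have hΓℝ : ∀ j, Complex.Gammaℝ (s + a j) ≠ 0 := fun j =>
      Complex.Gammaℝ_ne_zero_of_re_pos (by rw [Complex.add_re]; linarith [ha j])
    have hΓℂ : ∀ j, Complex.Gammaℂ (s + b j) ≠ 0 := fun j =>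
      Gammaℂ_ne_zero_of_re_pos (by rw [Complex.add_re]; linarith [hb j])
    have hcneg : (c : ℂ) ^ (-s) * (c : ℂ) ^ s = 1 := by
      rw [Complex.cpow_neg, inv_mul_cancel₀ hcs]
    calc (c : ℂ) ^ (-s) * ((∏ j, (Complex.Gammaℝ (s + a j))⁻¹) * ∏ j, (Complex.Gammaℂ (s + b j))⁻¹) *
          ((c : ℂ) ^ s * ((∏ j, Complex.Gammaℝ (s + a j)) * ∏ j, Complex.Gammaℂ (s + b j)))
        = ((c : ℂ) ^ (-s) * (c : ℂ) ^ s) *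
            (((∏ j, (Complex.Gammaℝ (s + a j))⁻¹) * ∏ j, Complex.Gammaℝ (s + a j)) *
              ((∏ j, (Complex.Gammaℂ (s + b j))⁻¹) * ∏ j, Complex.Gammaℂ (s + b j))) := by ring
      _ = 1 := by
        rw [hcneg, ← Finset.prod_mul_distrib, ← Finset.prod_mul_distrib,
          Finset.prod_eq_one fun j _ => inv_mul_cancel₀ (hΓℝ j),
          Finset.prod_eq_one fun j _ => inv_mul_cancel₀ (hΓℂ j)]
        ring

end Bridge

/-! ### The corollary: level-one pairs over `K` with trivial different, given the test-vector theorem -/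

section Final

open ValuativeRel

-- the automorphic quotient carries the tree's Borel σ-algebra, not Mathlib's quotient σ-algebra
attribute [-instance] Quotient.instMeasurableSpace QuotientGroup.measurableSpace

variable {n : ℕ} {K : Type} [Field K] [NumberField K]
variable {μ' : Measure (AdelicGroupData.gl n K).automorphicQuotient} [(AdelicGroupData.gl n K).IsAutomorphicMeasure μ']

attribute [local instance] adelicBorel borelSpace_adelic locallyCompactSpace_adelic secondCountableTopology_gl_adelic
  glAdeleBorel borelSpace_glAdele borelSpace_ideleGroup secondCountableTopology_ideleGroup

attribute [local instance] Literature.MeasureTheory.Group.hasSummableGeomSeries_of_finiteDimensional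
  Literature.MeasureTheory.Group.Units.borelSpace_of_isOpenEmbedding
  Literature.MeasureTheory.Group.Units.secondCountableTopology
  Literature.MeasureTheory.Group.Units.locallyCompactSpace

attribute [local instance] borelSpace_pi_mixedUnits measurableMul_pi_mixedUnits

variable [MeasurableSpace (AdeleRing (𝓞 K) K)] [BorelSpace (AdeleRing (𝓞 K) K)]
variable [MeasurableSpace (GL (Fin n) (mixedSpace K))] [BorelSpace (GL (Fin n) (mixedSpace K))]

/-- **Mœglin–Waldspurger, Appendice, Corollaire (i)(b), for level-one pairs over a field with trivial
different, from the archimedean test-vector theorem.** Let `K` be a number field with `𝔡_K = 1`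
(e.g. `K = ℚ`), `n ≥ 1`, multiplicity one for `GL_n / K`, and let `π`, `π'` be cuspidal automorphic
representations of `GL_n(𝔸_K)` with Satake parameters at EVERY finite place for the level `GL_n(𝒪_v)`
(everywhere unramified, level one) and `π ≠ π̄'` (i.e. `π' ≇ π^∨ = π̃`). Then for every finite set `T` of
finite places and Satake families `α`, `β` of `π`, `π'` off `T`, the partial Rankin–Selberg `L`-function
`L^T(s, π × π') = partialPairL T α β s` (`re s > 1`) extends to an ENTIRE function — granted the
archimedean input `HumphriesJo2024_archRankinSelberg_testVector n K` (Humphries–Jo, Thm. 1.1/5.6 with the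
Jacquet–Shalika local–global identification, vendored as a named fact in
`ArchRankinSelbergTestVector.lean`). This is `MoeglinWaldspurger1989_partialPairL_entire_of_ne_conj` for
such pairs; the proof is Cogdell's road (global Rankin–Selberg integrals against mirabolic Eisenstein
series, unfolding, the unramified computation, peeling of the finite places, and the archimedean
`Γ`-factor), assembled in `exists_entire_eq_partialPairL_of_levelOne_of_archPairLFactorData`.
[cite: MoeglinWaldspurger1989, Appendice, Corollaire (i)(b), p. 667]
[cite: CogdellAnalyticTheory2004, §3.2 and §4.1–§4.2] [cite: HumphriesJo2024, Thm. 1.1 and Thm. 5.6] -/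
theorem exists_entire_eq_partialPairL_of_levelOne_of_testVector
    (h : HumphriesJo2024_archRankinSelberg_testVector n K)
    (νI : Measure (ideleGroup K)) [νI.IsHaarMeasure]
    (νA : Measure (Fin n → ideleGroup K)) [IsHaarMeasure νA]
    (νK : Measure ↥(maximalCompactAdelic n K)) [IsHaarMeasure νK]
    (ν₀ : Measure ↥(adelicUnipotent n K)) [IsHaarMeasure ν₀]
    (hd : differentIdeal ℤ (𝓞 K) = ⊤) (hn : 0 < n) (h₁ : multiplicity_one_gl n K μ')
    (P P' : CuspidalAutomorphicRepGL n K μ') (hne : P ≠ P'.conj)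
    {α₀ β₀ : SatakeFamily K}
    (hP : ∀ v : HeightOneSpectrum (𝓞 K), ∃ ϖ : (v.adicCompletion K)ˣ,
      HasSatakeParameterAt P.1 (glIntegralLevel n K) v ϖ (α₀ v))
    (hP' : ∀ v : HeightOneSpectrum (𝓞 K), ∃ ϖ : (v.adicCompletion K)ˣ,
      HasSatakeParameterAt P'.1 (glIntegralLevel n K) v ϖ (β₀ v))
    {T : Set (HeightOneSpectrum (𝓞 K))} (hT : T.Finite) {α β : SatakeFamily K}
    (hα : IsSatakeFamilyOf P T α) (hβ : IsSatakeFamilyOf P' T β) :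
    ∃ g : ℂ → ℂ, Differentiable ℂ g ∧ ∀ s : ℂ, 1 < s.re → g s = partialPairL T α β s :=
  exists_entire_eq_partialPairL_of_levelOne_of_archPairLFactorData (archPairLFactorData_of_testVector h)
    νI νA νK ν₀ hd hn h₁ P P' hne hP hP' hT hα hβ

end Final

end Literature.NumberTheory.Automorphic
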